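import Summits.BirchSwinnertonDyer.Rank1Residual.Additive.AdditiveDoorExact
import Summits.BirchSwinnertonDyer.Rank1Residual.X11b.UnramifiedPrimaryVanishing
import HarnessLib

/-!
# The door of `A₀` is SHUT at every GOOD place `v ∤ p`: a `p`-torsion class dying in
# `H¹(H, E(K̄_v))` for some `H ⊇ I_v` is a local Kummer class
# (cell `b2b-bsdres`, team n1011, seat p06 GEN 5; OWNERS row T-E3g-DOOR, FILE D)

HONEST FRAMING (cell `b2b-bsdres`, run/shared/lean/b2b/bsd-rank1-residual/, verbatim in every
file): the goal of the cell is to DELETE the COMBINATION-SHAPED residual classes of the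
Birch–Swinnerton-Dyer formula for ALL analytic-rank `≤ 1` elliptic curves over `ℚ` — "full BSD
formula for every rank `≤ 1` curve in class `C`" assembled STRICTLY from published theorems — so
that the rank-`≤ 1` remainder becomes exactly the CONSTRUCTION-SHAPED classes, which are TYPED
(missing-input `Prop`s), NOT attempted. This is not "finishing BSD". Team n1011 (N10/N11: X4 ∧
`p = 3`): research routes on CONSTRUCTION-SHAPED classes; census output = EVIDENCE / conjecture
items, never a Literature fact; RESIDUAL-MAP marks UNCHANGED; nothing is booked by this file.
THEOREMS ONLY: no definition, no named fact, nothing asserted; a SIZING statement.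

## What (row T-E3g-DOOR, complement to FILES B2/C: the GOOD places)

At a place `v ∤ p` of GOOD reduction the binder `hI` of FILES B2/C fails (`I_v` acts trivially on
`E[p^∞]`), but the door is shut for a different reason: `H¹_ur(K_v, E[p^∞]) = 0` (X11b
`LocBridge.unramifiedSubgroup_primary_eq_bot`: `Frob − 1` is onto the divisible `E[p^∞]`;
Greenberg LNM 1716 Lemma 3.3 good case, "`ker r_v = 0`"; JSW17 §2.2.2 "`H¹_f(K_w, W) = 0`").
Hence, for ANY `H ≤ Γ_{K_v}` containing `absInertia K_v`:

* `mem_kummerLocalConditionAt_pow_of_resH1Hom_eq_zero_of_hasGoodReductionAt` /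
  `mem_kummerLocalConditionAt_of_resH1Hom_eq_zero_of_hasGoodReductionAt`: a class of
  `H¹(K_v, E[p^k])` dying in `H¹(H, E(K̄_v))` lies in `𝓚_v` (coefficient change of FILE B2
  `exists_geomPrimaryTorsion_eq_smul_sub_of_principal_on`; then its image in `H¹(K_v, E[p^∞])` is
  unramified, hence `0`, and `ker (H¹(E[p^k]) → H¹(E[p^∞])) = 𝓚_v` at `v ∤ p`);
* `resH1Hom_localSubgroup_map_eq_zero_iff_mem_kummer_of_hasGoodReductionAt` and, in p10's `A₀`
  currency, `layerToInfty_mem_localKerOver_iff_mem_kummer_of_hasGoodReductionAt`: **on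
  `p`-torsion classes the local condition of `Sel_{p^∞}(E/K_∞)` at a good `v ∤ p` IS the Kummer
  condition** (`←` through p10's p264947, `hdec` there only).

With FILE C: at every place `v ∤ p` that is not multiplicative, the door of the Route-G budget on
`p`-torsion classes is known exactly — `𝓚_v` (good; additive with `E(K_v)[p] = 0`) or
`H¹_ur ⊕ 𝓚_v` of index `p` (additive Tamagawa place). Multiplicative places: NOT claimed.

References: R. Greenberg, LNM 1716 (1999) §2 Prop. 2.1, §3 Lemma 3.3 [GreenbergLNM1716];
D. Jetchev, C. Skinner, X. Wan, Camb. J. Math. 5 (2017) §2.2.2 [JetchevSkinnerWan2017];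
J. S. Milne, *ADT* (2006) I Prop. 3.8 [MilneADT2006].
-/

set_option autoImplicit false

noncomputable section

open scoped Classical ContRepresentation

open CategoryTheory Field ValuativeRel NumberField IsDedekindDomain Function
open Literature.NumberTheory.EllipticCurves Literature.NumberTheory.GaloisRepresentations
  Literature.NumberTheory.GaloisRepresentations.IsNonarchimedeanLocalField
open Summit.BirchSwinnertonDyer.Rank1Residual.X11b
open WeierstrassCurve

namespace Summit.BirchSwinnertonDyer.Rank1Residual.Additive

-- `K : Type` (universe `0`): X11b's `LocBridge.unramifiedSubgroup_primary_eq_bot` is stated there.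
variable {K : Type} [Field K] [NumberField K] (W : WeierstrassCurve K) [W.IsElliptic] (p : ℕ)
  [hp : Fact p.Prime] (v : HeightOneSpectrum (𝓞 K))

/-- **Door SHUT at a GOOD place `v ∤ p` (general exponent).** For `H ≤ Γ_{K_v}` containing
`absInertia K_v`, a class `c ∈ H¹(K_v, E[p^k])` whose image in `H¹(H, E(K̄_v))` vanishes lies in the
local Kummer condition `𝓚_v`: its image in `H¹(K_v, E[p^∞])` is principal on `H ⊇ I_v` (FILE B2's
coefficient change), hence unramified, hence `0` (`H¹_ur(K_v, E[p^∞]) = 0` at good `v ∤ p`,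
X11b `LocBridge.unramifiedSubgroup_primary_eq_bot`), and the kernel of
`H¹(K_v, E[p^k]) → H¹(K_v, E[p^∞])` is `𝓚_v` at `v ∤ p`.
[cite: GreenbergLNM1716, §2 Prop. 2.1 and §3 Lemma 3.3 (good case)]
[cite: JetchevSkinnerWan2017, §2.2.2 (arXiv:1512.06894 p. 6)] -/
theorem mem_kummerLocalConditionAt_pow_of_resH1Hom_eq_zero_of_hasGoodReductionAt
    (hpv : ((p : ℕ) : 𝓞 K) ∉ v.asIdeal) (hv : W.HasGoodReductionAt v) (k : ℕ)
    (H : Subgroup (absoluteGaloisGroup (v.adicCompletion K)))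
    (hIH : absInertia (v.adicCompletion K) ≤ H)
    {c : galoisCohomology
      (GaloisRep.restrictField (v.adicCompletion K) (W.torsionGaloisModule ((p ^ k : ℕ) : ℤ))) 1}
    (hc : resH1Hom (Literature.NumberTheory.EllipticCurves.subgroupIncl H)
        (AddMonoidHom.id (localPoints W (v.adicCompletion K))) (fun _ _ ↦ rfl)
      (galoisCohomology.map (W.torsionPointsMapIntertwining ((p ^ k : ℕ) : ℤ) (v.adicCompletion K))
        1 c) = 0) :
    c ∈ W.kummerLocalConditionAt ((p ^ k : ℕ) : ℤ) (v.adicCompletion K) := by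
  have hn : ((p ^ k : ℕ) : ℤ) ≠ 0 := by exact_mod_cast pow_ne_zero k hp.out.ne_zero
  obtain ⟨φ, hφ⟩ := oneCocycleClass_surjective _ c
  -- unpack the vanishing in `H¹(H, E(K̄_v))`: `φ(h) = h R - R` on `H`
  rw [← hφ, W.map_torsionPointsMapIntertwining_oneCocycleClass,
    LocBridge.resH1Hom_oneCocycleClass_eq_zero_iff _ _ _ Function.bijective_id] at hc
  obtain ⟨R, hR⟩ := hc
  have hR' : ∀ h ∈ H, pointsMap W (v.adicCompletion K) (φ.1 h : W.geomTorsion ((p ^ k : ℕ) : ℤ)) =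
      h • R - R := fun h hh ↦ hR ⟨h, hh⟩
  -- coefficient change: `φ(h) = h Q - Q` on `H` with `Q ∈ E[p^∞]`
  obtain ⟨Q, hQ⟩ := exists_geomPrimaryTorsion_eq_smul_sub_of_principal_on W p v hpv k H hIH φ hR'
  -- the image of `c` in `H¹(K_v, E[p^∞])` is unramified, hence zero at a good place
  have hur : galoisCohomology.map
      ((Levels.primaryInclusion W p k).restrictField (v.adicCompletion K)) 1 c ∈
      DiscreteGaloisModule.unramifiedSubgroup
        (GaloisRep.restrictField (v.adicCompletion K) (LocBridge.primaryGaloisModule W p)) 1 := by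
    rw [← hφ, galoisCohomology.map_one_oneCocycleClass]
    refine (LocBridge.mem_unramifiedSubgroup_one_iff_exists _ _).mpr ⟨Q, fun τ hτ ↦ ?_⟩
    apply Subtype.ext
    rw [AddSubgroupClass.coe_sub]
    exact hQ τ (hIH hτ)
  rw [LocBridge.unramifiedSubgroup_primary_eq_bot W p hpv hv, AddSubgroup.mem_bot] at hur
  rw [LevelKummer.kummerLocalConditionAt_eq_ker_map_primaryInclusion W p k v hpv hn,
    AddMonoidHom.mem_ker]
  exact hur

/-- **Door SHUT at a GOOD place `v ∤ p`, `p`-torsion classes** (`(p : ℤ)` currency): a class of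
`H¹(K_v, E[p])` dying in `H¹(H, E(K̄_v))` for some `H ⊇ absInertia K_v` is a local Kummer class.
[cite: GreenbergLNM1716, §3 Lemma 3.3 (good case)] [cite: JetchevSkinnerWan2017, §2.2.2] -/
theorem mem_kummerLocalConditionAt_of_resH1Hom_eq_zero_of_hasGoodReductionAt
    (hpv : ((p : ℕ) : 𝓞 K) ∉ v.asIdeal) (hv : W.HasGoodReductionAt v)
    (H : Subgroup (absoluteGaloisGroup (v.adicCompletion K)))
    (hIH : absInertia (v.adicCompletion K) ≤ H)
    {c : galoisCohomology
      (GaloisRep.restrictField (v.adicCompletion K) (W.torsionGaloisModule (p : ℤ))) 1}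
    (hc : resH1Hom (Literature.NumberTheory.EllipticCurves.subgroupIncl H)
        (AddMonoidHom.id (localPoints W (v.adicCompletion K))) (fun _ _ ↦ rfl)
      (galoisCohomology.map (W.torsionPointsMapIntertwining (p : ℤ) (v.adicCompletion K)) 1 c) = 0) :
    c ∈ W.kummerLocalConditionAt (p : ℤ) (v.adicCompletion K) := by
  have h : ∀ {c : galoisCohomology
      (GaloisRep.restrictField (v.adicCompletion K) (W.torsionGaloisModule ((p ^ 1 : ℕ) : ℤ))) 1},
      resH1Hom (Literature.NumberTheory.EllipticCurves.subgroupIncl H)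
        (AddMonoidHom.id (localPoints W (v.adicCompletion K))) (fun _ _ ↦ rfl)
        (galoisCohomology.map
          (W.torsionPointsMapIntertwining ((p ^ 1 : ℕ) : ℤ) (v.adicCompletion K)) 1 c) = 0 →
      c ∈ W.kummerLocalConditionAt ((p ^ 1 : ℕ) : ℤ) (v.adicCompletion K) := fun hc ↦
    mem_kummerLocalConditionAt_pow_of_resH1Hom_eq_zero_of_hasGoodReductionAt W p v hpv hv 1 H hIH hc
  rw [pow_one] at h
  exact h hc

/-- **THE DOOR AT A GOOD PLACE `v ∤ p` (`iff`; `hdec` for `←` only — p10's p264947):** a class of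
`H¹(K_v, E[p])` dies in `H¹(Gal(K̄_v/K_{∞,η}), E(K̄_v))` IFF it is a local Kummer class.
[cite: GreenbergLNM1716, §3 Lemma 3.3 (good case)] [cite: MilneADT2006, Ch. I Prop. 3.8] -/
theorem resH1Hom_localSubgroup_map_eq_zero_iff_mem_kummer_of_hasGoodReductionAt
    (κ : ZpExtension K p) (hpv : ((p : ℕ) : 𝓞 K) ∉ v.asIdeal) (hv : W.HasGoodReductionAt v)
    (hdec : ∃ σ : absoluteGaloisGroup (v.adicCompletion K),
      κ (resGal (K := K) (v.adicCompletion K) σ) ≠ 1)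
    (c : galoisCohomology
      (GaloisRep.restrictField (v.adicCompletion K) (W.torsionGaloisModule (p : ℤ))) 1) :
    resH1Hom (Literature.NumberTheory.EllipticCurves.subgroupIncl
        (localSubgroup κ.kerSubgroup (v.adicCompletion K)))
        (AddMonoidHom.id (localPoints W (v.adicCompletion K))) (fun _ _ ↦ rfl)
      (galoisCohomology.map (W.torsionPointsMapIntertwining (p : ℤ) (v.adicCompletion K)) 1 c) = 0 ↔
    c ∈ W.kummerLocalConditionAt (p : ℤ) (v.adicCompletion K) :=
  ⟨fun hc ↦ mem_kummerLocalConditionAt_of_resH1Hom_eq_zero_of_hasGoodReductionAt W p v hpv hv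
      (localSubgroup κ.kerSubgroup (v.adicCompletion K))
      (absInertia_le_localSubgroup_kerSubgroup p v κ hpv) hc,
    fun hc ↦ resH1Hom_localSubgroup_map_eq_zero_of_mem_unramified_sup_kummer W p κ v hpv hdec
      (AddSubgroup.mem_sup_right hc)⟩

/-- **THE DOOR of `A₀` at a GOOD place `v ∤ p` in p10's currency (`iff`; `hdec` for `←` only):**
`h₀(Ψ y)` satisfies the local condition of `Sel_{p^∞}(E/K_∞)` at `v` IFF `res_v y ∈ 𝓚_v` — good
places contribute nothing to `A₀[p]` beyond the Selmer condition.
[cite: GreenbergLNM1716, §3 Lemma 3.3 (good case) and §5 pp. 114–118] -/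
theorem layerToInfty_mem_localKerOver_iff_mem_kummer_of_hasGoodReductionAt
    (κ : ZpExtension K p) (hpv : ((p : ℕ) : 𝓞 K) ∉ v.asIdeal) (hv : W.HasGoodReductionAt v)
    (hdec : ∃ σ : absoluteGaloisGroup (v.adicCompletion K),
      κ (resGal (K := K) (v.adicCompletion K) σ) ≠ 1)
    (y : galH1Torsion W (p : ℤ)) :
    W.layerToInfty κ 0 (resH1Hom (Literature.NumberTheory.EllipticCurves.subgroupIncl (κ.layerSubgroup 0))
        (AddMonoidHom.id (geomPrimaryTorsion W p)) (fun _ _ ↦ rfl) (torsionToPrimaryH1 W p y)) ∈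
      W.localKerOver p κ.kerSubgroup (v.adicCompletion K) ↔
    galoisCohomology.res (W.torsionGaloisModule (p : ℤ)) (v.adicCompletion K) 1 y ∈
      W.kummerLocalConditionAt (p : ℤ) (v.adicCompletion K) := by
  rw [mem_localKerOver_iff, localResOver_layerToInfty_torsionToPrimaryH1_eq]
  exact resH1Hom_localSubgroup_map_eq_zero_iff_mem_kummer_of_hasGoodReductionAt W p v κ hpv hv hdec _

end Summit.BirchSwinnertonDyer.Rank1Residual.Additive

end
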